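import Summits.ValiantsHypothesis.ValiantsHypothesis.Theorems.MonotoneRestorationOrbitRestorationQPEvenNewton
import Summits.ValiantsHypothesis.ValiantsHypothesis.Theorems.MonotoneRestorationOrbitRestorationQPValueOrbitFinset
import Summits.ValiantsHypothesis.ValiantsHypothesis.Theorems.MonotoneRestorationOrbitRestorationQPRestorable
import HarnessLib

/-!
# `e_{2m}` of the column Vandermondes is orbit-restorable with ONE constant for ALL `m` — including the exponential
# regime `m ≈ n/4` (a matrix-symmetric VP instance of the crux outside the depth-three rung)

Route MonotoneRestoration, crux `OrbitRestorationQP` (stmt-ValiantsHypothesis-18293), line `depth-three-rung`; namespace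
`Summit.ValiantsHypothesis.ValiantsHypothesis.Theorems.EvenNewton`.

`…TermBlocksEvenVandermondes.lean` restores `P_{m,n} = e_{2m}(D_1, …, D_n)` (`D_j = Π_{i<i'} (x_{ij} − x_{i'j})`) with the
constant `2m + 7` — useless when `m` grows with `n`, where the representation `Σ_{|T|=2m} Π_{j∈T} D_j` has `C(n,2m)` terms
whose orbits are not quasi-polynomial, so NO term-by-term symmetrisation can work, and the odd quantities `e_{2m±1}(D)`,
`p_{2i+1}(D)` through which Newton's recursion passes are never values of a small-orbit computation
(`ValueSymSupport.exists_symSupport`).  Still: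

* `qpOrbitRestorable_evenESymm_columnVandermondes_uniform` — **`e_{2m}(D_1,…,D_n)` is `QPOrbitRestorable 24 n` for ALL
  `m, n`.**  Proof: `e_{2m} ∈ Algebra.adjoin ℂ {p_{2k}} ∪ {p_{2a+1} p_{2b+1}}` (`EvenNewton.esymm_mem_evenSubalgebra`), so
  `e_{2m} = P(p_{2k}, p_{2a+1} p_{2b+1})` for a polynomial `P` (`Algebra.adjoin_eq_range`); substitute `X_j ↦ D_j`
  (`MvPolynomial.aeval_bind₁`, `aeval_esymm_eq_multiset_esymm`): the generators become the INVARIANT restorable values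
  `p_{2k}(D)`, `p_{2a+1}(D) p_{2b+1}(D)` (`TermBlocks.qpOrbitRestorable_psum_mul_psum_columnVandermondes`, constant `9`;
  `12` after rescaling `p_{2k}(D) = n^{-1} · p_{2k}(D) p_0(D)`), and a polynomial expression in invariant restorable values
  is restorable at uniform cost (`ValueOrbit.qpOrbitRestorable_finset_prod/sum`, `qpOrbitRestorable_smul`: `+3` per
  level, four levels) — the number of monomials of `P` is irrelevant in orbit currency.
* `qpOrbitRestorable_aeval_of_generators` — the general step: a polynomial expression in `QPOrbitRestorable c`
  values is `QPOrbitRestorable (c + 12)`.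

So this family is no witness against the crux.  Nothing here bears on VP ≠ VNP.  Everything is proved. [folklore]

## References
* I. G. Macdonald, *Symmetric Functions and Hall Polynomials*, 2nd ed. (1995), §I.2. [Macdonald1995]
* A. Dawar, G. Wilsenach, *Symmetric arithmetic circuits*, ToC 21 (2025), §3.3. [DawarWilsenach2025]
-/

noncomputable section

open scoped Classical

-- `Summit.ValiantsHypothesis.ValiantsHypothesis.…` is the tree's single-conjunct layout (Sub = Summit).
set_option linter.dupNamespace false

namespace Summit.ValiantsHypothesis.ValiantsHypothesis.Theorems

namespace EvenNewton

open MvPolynomial Finset Literature.Computability.AlgebraicComplexity OrbitRestorationQPDepthThreeRung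

variable {n : ℕ}

/-- **A polynomial expression in restorable values is restorable at uniform cost** (`+12`: powers, monomials,
coefficients, sum). [folklore; cite: DawarWilsenach2025, §3.3] -/
theorem qpOrbitRestorable_aeval_of_generators {c : ℕ} {ι : Type*} (y : ι → MvPolynomial (Fin n × Fin n) ℂ)
    (hy : ∀ i, QPOrbitRestorable c n (y i)) (P : MvPolynomial ι ℂ) :
    QPOrbitRestorable (c + 12) n (aeval y P) := by
  rw [aeval_def, eval₂_eq]
  have h1 : ∀ (i : ι) (e : ℕ), QPOrbitRestorable (c + 3) n (y i ^ e) := by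
    intro i e
    have h := ValueOrbit.qpOrbitRestorable_finset_prod (Finset.range e) (fun _ => y i) fun _ _ => hy i
    rwa [Finset.prod_const, Finset.card_range] at h
  have h2 : ∀ d : ι →₀ ℕ, QPOrbitRestorable (c + 6) n (∏ i ∈ d.support, y i ^ d i) := fun d =>
    ValueOrbit.qpOrbitRestorable_finset_prod _ _ fun i _ => h1 i (d i)
  have h3 : ∀ d : ι →₀ ℕ, QPOrbitRestorable (c + 9) n
      ((algebraMap ℂ (MvPolynomial (Fin n × Fin n) ℂ)) (P.coeff d) * ∏ i ∈ d.support, y i ^ d i) := fun d => by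
    rw [MvPolynomial.algebraMap_eq]
    exact ValueOrbit.qpOrbitRestorable_smul _ (h2 d)
  exact ValueOrbit.qpOrbitRestorable_finset_sum _ _ fun d _ => h3 d

/-- **`e_{2m}(D_1,…,D_n)` IS ORBIT-RESTORABLE WITH THE CONSTANT `24`, FOR ALL `m` AND `n`.**
[folklore; cite: Macdonald1995, §I.2; DawarWilsenach2025, §3.3] -/
theorem qpOrbitRestorable_evenESymm_columnVandermondes_uniform (m n : ℕ) :
    QPOrbitRestorable 24 n
      (∑ T ∈ (univ : Finset (Fin n)).powersetCard (2 * m),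
        ∏ j ∈ T, ∏ i : Fin n, ∏ i' ∈ Ioi i, (X (i, j) - X (i', j) : MvPolynomial (Fin n × Fin n) ℂ)) := by
  -- the column Vandermondes and the substitution `X_j ↦ D_j`
  set D : Fin n → MvPolynomial (Fin n × Fin n) ℂ :=
    fun j => ∏ i : Fin n, ∏ i' ∈ Ioi i, (X (i, j) - X (i', j)) with hDdef
  -- the generators of the even subalgebra, as one family
  set g : ℕ ⊕ (ℕ × ℕ) → MvPolynomial (Fin n) ℂ :=
    Sum.elim (fun j => psum (Fin n) ℂ (2 * j)) (fun ab => psum (Fin n) ℂ (2 * ab.1 + 1) * psum (Fin n) ℂ (2 * ab.2 + 1))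
    with hg
  have hrange : Set.range g = (Set.range fun j : ℕ => psum (Fin n) ℂ (2 * j)) ∪
      Set.range fun ab : ℕ × ℕ => psum (Fin n) ℂ (2 * ab.1 + 1) * psum (Fin n) ℂ (2 * ab.2 + 1) := by
    rw [hg, Set.Sum.elim_range]
  -- `e_{2m}` is a polynomial in the generators
  have hmem : esymm (Fin n) ℂ (2 * m) ∈ (MvPolynomial.aeval (R := ℂ) g).range := by
    rw [← Algebra.adjoin_range_eq_range_aeval (R := ℂ), hrange]
    exact esymm_mem_evenSubalgebra m
  obtain ⟨P, hP⟩ := (AlgHom.mem_range _).1 hmem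
  -- substitute the column Vandermondes
  have hsubst : aeval D (esymm (Fin n) ℂ (2 * m)) =
      ∑ T ∈ (univ : Finset (Fin n)).powersetCard (2 * m), ∏ j ∈ T, D j := by
    rw [aeval_esymm_eq_multiset_esymm, Finset.esymm_map_val]
  have hDT : (∑ T ∈ (univ : Finset (Fin n)).powersetCard (2 * m), ∏ j ∈ T, D j) =
      ∑ T ∈ (univ : Finset (Fin n)).powersetCard (2 * m),
        ∏ j ∈ T, ∏ i : Fin n, ∏ i' ∈ Ioi i, (X (i, j) - X (i', j) : MvPolynomial (Fin n × Fin n) ℂ) := by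
    rfl
  rw [← hDT, ← hsubst, ← hP, aeval_eq_bind₁ g, aeval_bind₁]
  -- the substituted generators are restorable invariants with one constant
  have hpsum : ∀ k : ℕ, aeval D (psum (Fin n) ℂ k) = ∑ j : Fin n, D j ^ k := by
    intro k; simp only [psum, map_sum, map_pow, aeval_X]
  have hpp : ∀ a b : ℕ, Even (a + b) →
      QPOrbitRestorable 9 n ((∑ j : Fin n, D j ^ a) * ∑ j : Fin n, D j ^ b) := fun a b hab =>
    TermBlocks.qpOrbitRestorable_psum_mul_psum_columnVandermondes a b n hab
  have hgen : ∀ i, QPOrbitRestorable 12 n (aeval D (g i)) := by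
    rintro (j | ⟨a, b⟩)
    · -- even power sums: `p_{2j}(D) · p_0(D) = n · p_{2j}(D)`
      simp only [hg, Sum.elim_inl, hpsum]
      have h0 : (∑ t : Fin n, D t ^ 0) = C (n : ℂ) := by
        simp only [pow_zero, sum_const, card_univ, Fintype.card_fin, nsmul_eq_mul, mul_one, map_natCast]
      have hprod := hpp (2 * j) 0 ⟨j, by ring⟩
      rw [h0] at hprod
      rcases Nat.eq_zero_or_pos n with hn | hn
      · subst hn
        have hz : (∑ t : Fin 0, D t ^ (2 * j)) = C 0 := by simp
        rw [hz]
        exact Restorable.qpOrbitRestorable_mono (by norm_num) (Restorable.qpOrbitRestorable_C 0)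
      · have hn0 : ((n : ℂ)) ≠ 0 := Nat.cast_ne_zero.2 hn.ne'
        have hre : (∑ t : Fin n, D t ^ (2 * j)) = C ((n : ℂ)⁻¹) * ((∑ t : Fin n, D t ^ (2 * j)) * C (n : ℂ)) := by
          rw [mul_comm (∑ t : Fin n, D t ^ (2 * j)) (C (n : ℂ)), ← mul_assoc, ← map_mul, inv_mul_cancel₀ hn0,
            map_one, one_mul]
        rw [hre]
        exact ValueOrbit.qpOrbitRestorable_smul _ hprod
    · -- products of two odd power sums
      simp only [hg, Sum.elim_inr, map_mul, hpsum]
      exact Restorable.qpOrbitRestorable_mono (by norm_num) (hpp _ _ ⟨a + b + 1, by ring⟩)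
  exact qpOrbitRestorable_aeval_of_generators _ hgen P

/-- **THE EVEN SUBALGEBRA OF THE COLUMN VANDERMONDES RESTORES, UNIFORMLY.**  For every `n` and every polynomial `P`
(over `ℂ`, in variables indexed by `ℕ ⊕ ℕ × ℕ`, any number of monomials), the value of `P` at the invariant generators
`p_{2k}(D) = Σ_j D_j^{2k}` (index `inl k`) and `p_{2a+1}(D) · p_{2b+1}(D)` (index `inr (a,b)`), `D_j` the column
Vandermondes, is `QPOrbitRestorable 24 n`.  In particular every FIXED even symmetric polynomial of the `D_j` that is a
polynomial in these generators restores uniformly in `n`. [folklore; cite: DawarWilsenach2025, §3.3] -/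
theorem qpOrbitRestorable_aeval_evenGenerators_columnVandermondes (n : ℕ) (P : MvPolynomial (ℕ ⊕ (ℕ × ℕ)) ℂ) :
    QPOrbitRestorable 24 n
      (aeval (Sum.elim
        (fun k : ℕ => ∑ j : Fin n,
          (∏ i : Fin n, ∏ i' ∈ Ioi i, (X (i, j) - X (i', j) : MvPolynomial (Fin n × Fin n) ℂ)) ^ (2 * k))
        (fun ab : ℕ × ℕ => (∑ j : Fin n,
          (∏ i : Fin n, ∏ i' ∈ Ioi i, (X (i, j) - X (i', j) : MvPolynomial (Fin n × Fin n) ℂ)) ^ (2 * ab.1 + 1)) *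
          ∑ j : Fin n,
            (∏ i : Fin n, ∏ i' ∈ Ioi i, (X (i, j) - X (i', j) : MvPolynomial (Fin n × Fin n) ℂ)) ^ (2 * ab.2 + 1)))
        P) := by
  set D : Fin n → MvPolynomial (Fin n × Fin n) ℂ :=
    fun j => ∏ i : Fin n, ∏ i' ∈ Ioi i, (X (i, j) - X (i', j)) with hDdef
  have hpp : ∀ a b : ℕ, Even (a + b) →
      QPOrbitRestorable 9 n ((∑ j : Fin n, D j ^ a) * ∑ j : Fin n, D j ^ b) := fun a b hab =>
    TermBlocks.qpOrbitRestorable_psum_mul_psum_columnVandermondes a b n hab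
  refine qpOrbitRestorable_aeval_of_generators (c := 12) _ (fun i => ?_) P
  rcases i with k | ⟨a, b⟩
  · -- even power sums: `p_{2k}(D) · p_0(D) = n · p_{2k}(D)`
    simp only [Sum.elim_inl]
    show QPOrbitRestorable 12 n (∑ j : Fin n, D j ^ (2 * k))
    have h0 : (∑ t : Fin n, D t ^ 0) = C (n : ℂ) := by
      simp only [pow_zero, sum_const, card_univ, Fintype.card_fin, nsmul_eq_mul, mul_one, map_natCast]
    have hprod := hpp (2 * k) 0 ⟨k, by ring⟩
    rw [h0] at hprod
    rcases Nat.eq_zero_or_pos n with hn | hn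
    · subst hn
      have hz : (∑ t : Fin 0, D t ^ (2 * k)) = C 0 := by simp
      rw [hz]
      exact Restorable.qpOrbitRestorable_mono (by norm_num) (Restorable.qpOrbitRestorable_C 0)
    · have hn0 : ((n : ℂ)) ≠ 0 := Nat.cast_ne_zero.2 hn.ne'
      have hre : (∑ t : Fin n, D t ^ (2 * k)) = C ((n : ℂ)⁻¹) * ((∑ t : Fin n, D t ^ (2 * k)) * C (n : ℂ)) := by
        rw [mul_comm (∑ t : Fin n, D t ^ (2 * k)) (C (n : ℂ)), ← mul_assoc, ← map_mul, inv_mul_cancel₀ hn0,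
          map_one, one_mul]
      rw [hre]
      exact ValueOrbit.qpOrbitRestorable_smul _ hprod
  · simp only [Sum.elim_inr]
    show QPOrbitRestorable 12 n ((∑ j : Fin n, D j ^ (2 * a + 1)) * ∑ j : Fin n, D j ^ (2 * b + 1))
    exact Restorable.qpOrbitRestorable_mono (by norm_num) (hpp _ _ ⟨a + b + 1, by ring⟩)

end EvenNewton

end Summit.ValiantsHypothesis.ValiantsHypothesis.Theorems

end
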